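import Literature.MathematicalPhysics.QuantumFieldTheory.Balaban1983to89.B15Claim189ZppOfRecordPin

/-!
# `Balaban1983to89.B15Claim189HypothesesOfRecord` — YM-DAG node N12 · [Balaban1989LargeFieldI] CMP **122** (1989) 175–202, p. 177 (i)–(ii) and (1.10)–(1.12) p. 179 with
# [Balaban1988Convergent] (2.1)–(2.3), (2.13), (3.5): lit-balaban p29's LOCATED `Hypotheses` FOR THE (1.10)–(1.12) CONSTRUCTION, AT THE TERM's DATA OF RECORD — six numeric fields and
# THE ADMISSIBILITY OF THE (2.1)-CHAIN DISCHARGED FROM THE RECORD (the separation of record), the two located facts about the component union `Z` displayed in torus form — so that module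
# 19's structure of the (1.89) situation's `Z″_j` holds from RECORD inputs

statement-level bookkeeping over published theorems with citation tags; kernel-checked compositions of tree theorems; nothing here is a claim about the Yang–Mills
mass gap.

CITATION HEADER (lean-in-tree rule).  Sources, verbatim: [Balaban1989LargeFieldI] («[IV]») p. 177: *"(i) it is contained in a cube of the size 100MR_k, (ii) in the preceding N
renormalization steps no new large field regions were created inside this component, and the previous regions contained in it satisfy the condition (i) on the corresponding scales.
… Let us denote the union of the above class of components by Z"* (components of the large field region `Λ_kᶜ`); p. 179 (1.10)–(1.12) (quoted in module 19), *"The sequence {Ω″_j} is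
an admissible sequence"*; [Balaban1988Convergent] («[III]») p. 254 (2.1): *"Ω₁ ⊃ Λ₁ ⊃ Ω₂ ⊃ Λ₂ ⊃ … ⊃ Ω_k ⊃ Λ_k"*, (2.2)–(2.3) p. 254–255, p. 256: *"a sequence of maximal domains Ω = Ω₀ ⊃ Ω₁ ⊃
… ⊃ Ω_j such that Ω_n is a union of LⁿξM₁-cubes, and dist(Ω_n, Ωᶜ_{n−1}) ≧ LⁿξM₁"* ((2.13), the admissibility notion typed by p29 as `Admissible`), (3.5) p. 265 (the one-step rule
putting `Ω_{j+1}` eight layers inside `Λ_j`); [Balaban1987RG1] (0.1) p. 251 (the torus).  Seat `pub-ymgap-dag-n12-e` (YM-PLAN Track A, HUMAN RULING D-0062; director-ym R134 row N12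
s3), generation 7, module 20.  BY NAME and UNCHANGED: p29 g14 `B15Eq112Admissible` (`Admissible`, `ClassZ`, `Hypotheses`), p29 g17 `B15Eq112TorusCover` (`cover`, `per`, `lift`,
`cover_eq_cover_iff`, `cover_add_pmul`, `pullSeq`), p29 g13 `B15LatticeCubeTorus.pmul`, pv02 `B14DomainGeom` (`cubeIdx`, `IsUnionOfCubes`, `IdxNear`, `enl`, `enl_mono_layers`,
`idxNear_of_within`, `Within`), r11 `B14.Eq213MaximalDomains.side`, def-R's `Node00.unionsOfCubes ∕ dCubeSide ∕ DOfRecord ∕ cubeEnl ∕ RkOfRecord`, def-T's `Node00.hullD ∕ sideD`, r11's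
`B14.Eq218Concrete.Chain21` (`memΩ`, `Λ_subset`) through the (2.18) index of record `SeqOfRecord`, dag-n11-e's `B14SeparationOfRecord` (`one_le_RkOfRecord`,
`separated_of_slotsOfRecord₁₃_ne_zero`), module 11 (`omegaOfChain`, `omegaOfChain_eq`), module 12 (`two_le_L`), module 16 (`enlD`, `dCubeSide_pos`), module 19
(`preimage_cover_hullD`, `cubeIdx_of_mem_cubeExt_zero`, `mem_cubeExt_of_abs_cubeIdx_sub_le`, `cubeIdx_add_pmul`, `dCubeSide_eq_side_mul`, `omegaT` + lemmas, `zppOfRecordT`,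
`Sit189.pinZres`, `Zpp_stack_structure`).

WHY THIS FILE.  Module 19 made the (1.89) situation's new large-field regions `Z″_j`, `j > h`, lit-balaban's torus regions of record and transferred p29's certified structure (nested,
disjoint from `Ω_j`, `Z ∖ Z″_{h+1} ⊆ Ω_h`, (1.12) admissible) BY NAME — under p29's located `Hypotheses` bundle on the cover data `(pullSeq (omegaT s), π⁻¹Z)`: nine fields.  Seven of
them are facts the RECORD supplies: `2 ≤ L` (the torus), `1 ≤ M`, `1 ≤ R_j` ((2.5)), `h < k₀` and `k₀ + 2 ≤ k′` (`2 ≤ N₀ < N ≤ k′`), the `N₀`-equation (p29's `hN₀`; module 16 §3), and —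
the substantial one — `adm`, *the (2.1)-chain of the term is a [III]-(2.13)-admissible sequence* (unions of `L^jM`-cubes, consecutive members one layer apart): it follows from the (2.18)
index of record (`Ω_j ∈ 𝐃_j`, `Chain21.memΩ`) and THE SEPARATION OF RECORD in dag-n11-e's form `hullD (sideD … j) 3 (Ω_{j+1}) ⊆ Λ_j` — a theorem for every sequence charged by a density of
record (`B14SeparationOfRecord` §4) — read on the cover through module 19's bridge `preimage_cover_hullD` and this file's `isUnionOfCubes_preimage_cover`.  The two remaining fields are
p. 177's located readings about the term's component union `Z` — (ii) as the eight-layer margin `Z ∩ Ω_{j+1}^{∼8} ⊆ Ω_j` for the last `N` steps ([III] (3.5)), and *«the union of the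
above class of components»* of `Λ_kᶜ` as «`Z` a union of `𝐃_{k′}`-cubes, closed under cube-adjacency outside `Ω_{k′}`» — displayed here in TORUS form (term data, like `Λ ≠ ∅`).

* §1 cover-side readers of def-R's cube classes: `isUnionOfCubes_of_mul`, `isUnionOfCubes_univ`, `cover_mem_cubeEnl_zero_of_cubeIdx_eq`, ★ `isUnionOfCubes_preimage_cover`,
  `cover_mem_hullD_singleton_of_idxNear`.
* §2 `sideD_eq` (`rfl`), ★ **`admissible_pullSeq_omegaT`** (the chain of record, pulled back with `Ω₀ = T_η`, is p29-admissible from `memΩ` + the separation of record),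
  ★★ **`hypotheses_of_record`**.
* §3 ★★★ **`Zpp_stack_structure_of_record`** — module 19's `Zpp_stack_structure` with `H` SUPPLIED: the situation's `Z″`-structure from record inputs + the two `Z`-facts;
  `admissible_pullSeq_omegaT₁₃_of_slots_ne_zero` — at Record 13 the separation input IS dag-n11-e's `separated_of_slotsOfRecord₁₃_ne_zero` for every charged term.

LOCATED (nothing asserted): (i) the divisibilities `L^jMR_j ∣ 2L^{m+K}` (`1 ≤ j ≤ k′`) and p29's level-0 `M·R₀ ∣ 2L^{m+K}` are print's standing arrangement of compatible partitions
(node00-def's numeric admissibility, [DAGN11A-G2-READING-1-CUBESIDE]) — displayed; (ii) the separation input is displayed in dag-n11-e's shape: the (2.18) sum of record ranges over all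
nested sequences, only the CHARGED ones are separated (§3's Record-13 corollary takes the non-zero slot as the hypothesis); (iii) the two `Z`-facts are the term's, not derivable from the
chain; p29's `ClassZ` reads adjacency on the cover, the torus form displayed here implies it (`cover_mem_hullD_singleton_of_idxNear`) and is what a model of p. 177's components would
prove; (iv) `Ω₀ = T_η` (module 19's `omegaT`) makes p29's level-0 clauses trivial, as in p29's own instances.

HONEST FRAMING.  Count-neutral: set geometry on the cover ∕ torus and by-name knits; NO estimate of Bałaban's asserted; N12 NOT discharged; one finite four-torus programme at fixed
`ε`, Bałaban AS PRINTED with locators; nothing continuum ∕ ℝ⁴ ∕ OS ∕ mass gap ∕ Clay.  No `sorry`, no `axiom`, no `instance`, no `notation`, no `def`.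
-/

noncomputable section

namespace Literature.MathematicalPhysics.QuantumFieldTheory.Balaban1983to89

namespace B15Claim189HypothesesOfRecord

open DagBinding T4Continuum Node00
open B14DomainGeom (Pt cubeIdx IsUnionOfCubes IdxNear enl subset_enl enl_mono_layers idxNear_of_within Within)
open B14.Eq213MaximalDomains (side cubeExt)
open B15Eq112TorusCover (cover lift per cover_lift cover_eq_cover_iff cover_add_pmul image_preimage pullSeq)
open B15LatticeCubeTorus (pmul)
open B15Claim189ZppOfRecordPin (cubeIdx_of_mem_cubeExt_zero mem_cubeExt_of_abs_cubeIdx_sub_le cubeIdx_add_pmul preimage_cover_hullD dCubeSide_eq_side_mul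
  omegaT omegaT_zero omegaT_of_ne_zero pullSeq_omegaT_of_ne_zero)

/-! ## §1. Cover-side readers of def-R's cube classes -/

section Bridge

variable {P : Params}

/-- A union of `s·t`-cubes is a union of `s`-cubes (nested partitions, [III] p. 265 *«compatible with all the other partitions»*; p29's private lemma of `B15Eq112Admissible` §1,
restated for use here). [cite: Balaban1988Convergent, p.265 (bookkeeping)] -/
theorem isUnionOfCubes_of_mul {d s t : ℕ} {X : Set (Pt d)} (h : IsUnionOfCubes (s * t) X) : IsUnionOfCubes s X := by
  intro x y hxy
  apply h
  funext i
  have hi := congrFun hxy i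
  unfold cubeIdx at hi ⊢
  push_cast
  rw [← Int.ediv_ediv_of_nonneg (Int.natCast_nonneg s), ← Int.ediv_ediv_of_nonneg (Int.natCast_nonneg s), hi]

/-- The whole space is a union of cubes. [folklore] [cite: Balaban1988Convergent, (2.1) p.254 (bookkeeping)] -/
theorem isUnionOfCubes_univ {d : ℕ} (s : ℕ) : IsUnionOfCubes s (Set.univ : Set (Pt d)) := fun _ _ _ => Iff.rfl

/-- Membership in the pull-back of one partition cube of `T_η`: the points of the cover whose `s`-cube index is `a` up to a deck translation of indices (side dividing the period).
[cite: Balaban1988Convergent, (2.16)–(2.17) p.257; Balaban1987RG1, (0.1) p.251 (bookkeeping)] -/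
theorem cover_mem_cubeEnl_zero_of_cubeIdx_eq {s : ℕ} (hs : 0 < s) (hdvd : s ∣ P.sitesPerDir 0) {a x y : Pt P.d} (hx : cover P x ∈ cubeEnl P s a 0)
    (hxy : cubeIdx s x = cubeIdx s y) : cover P y ∈ cubeEnl P s a 0 := by
  obtain ⟨x', hx', hxx'⟩ := hx
  obtain ⟨v, rfl⟩ := (cover_eq_cover_iff x' x).1 (by rw [hxx'])
  have ha : cubeIdx s x' = a := cubeIdx_of_mem_cubeExt_zero hs (by simpa using hx')
  refine ⟨y + pmul (per P) (-v), ?_, by simp [cover_add_pmul]⟩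
  have h0 : ((0 * s : ℕ) : ℤ) = 0 := by simp
  have hmem := mem_cubeExt_of_abs_cubeIdx_sub_le (P := P) hs 0 (y := y + pmul (per P) (-v)) (a := a) (fun i => ?_)
  · simpa using hmem
  · have h' := congrFun hxy i
    rw [cubeIdx_add_pmul hs hdvd] at h'
    rw [cubeIdx_add_pmul hs hdvd, ← ha, ← h']
    have : cubeIdx s x' i + ((P.sitesPerDir 0 / s : ℕ) : ℤ) * v i + ((P.sitesPerDir 0 / s : ℕ) : ℤ) * (-v) i - cubeIdx s x' i = 0 := by
      simp only [Pi.neg_apply]; ring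
    rw [this]; simp

/-- ★ **A UNION OF PARTITION CUBES OF `T_η`, PULLED BACK TO THE COVER, IS A UNION OF CUBES in pv02's sense** (side dividing the period): membership of `π x` in `X ∈ unionsOfCubes P s`
depends on the `s`-cube index of `x` only. [cite: Balaban1988Convergent, (2.1) p.254, (2.16)–(2.17) p.257; Balaban1987RG1, (0.1) p.251] -/
theorem isUnionOfCubes_preimage_cover {s : ℕ} (hs : 0 < s) (hdvd : s ∣ P.sitesPerDir 0) {X : Set (Site P 0)} (hX : X ∈ unionsOfCubes P s) :
    IsUnionOfCubes s (cover P ⁻¹' X) := by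
  obtain ⟨A, -, rfl⟩ := hX
  have key : ∀ x y : Pt P.d, cubeIdx s x = cubeIdx s y → cover P x ∈ (⋃ a ∈ A, cubeEnl P s a 0) → cover P y ∈ (⋃ a ∈ A, cubeEnl P s a 0) := by
    intro x y hxy hx
    obtain ⟨a, ha, hxa⟩ := Set.mem_iUnion₂.1 hx
    exact Set.mem_iUnion₂.2 ⟨a, ha, cover_mem_cubeEnl_zero_of_cubeIdx_eq hs hdvd hxa hxy⟩
  intro x y hxy
  exact ⟨key x y hxy, key y x hxy.symm⟩

/-- **CUBE-ADJACENCY ON THE COVER GIVES MEMBERSHIP IN A ONE-LAYER HULL ON THE TORUS**: `IdxNear s n x y` for points of the cover implies `π x ∈ hullD P s n {π y}` (side dividing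
the period) — the torus reading of p29's adjacency in `ClassZ.closed`. [cite: Balaban1988Convergent, p.264–265; Balaban1987RG1, (0.1) p.251 (bookkeeping)] -/
theorem cover_mem_hullD_singleton_of_idxNear {s n : ℕ} (hs : 0 < s) (hdvd : s ∣ P.sitesPerDir 0) {x y : Pt P.d} (h : IdxNear s n x y) :
    cover P x ∈ hullD P s n {cover P y} := by
  rw [← Set.mem_preimage, preimage_cover_hullD hs hdvd]
  exact ⟨y, rfl, h⟩

end Bridge

/-! ## §2. The term's (2.1)-chain, pulled back to the cover, IS [III]-(2.13)-ADMISSIBLE in p29's sense — from the separation of record -/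

section Adm

open B15Claim189PrintedConditions (omegaOfChain omegaOfChain_eq)
open B15Claim189LambdaPin (dCubeSide_pos)
open B15Eq112Admissible (Admissible Hypotheses ClassZ)

variable {F : T4Family} {ν : Stage7Numerics} {M : ℕ} {P : B12.RunParams} {g : ℕ → ℝ} {k' : ℕ}

/-- `sideD … j` of node00-def-T IS def-R's `𝐃_{j+1}`-cube side (`rfl`). [cite: Balaban1988Convergent, (2.1) p.254 (bookkeeping)] -/
theorem sideD_eq (j : ℕ) : sideD F ν M P g j = dCubeSide (F.P P.K).L M (RkOfRecord (F.P P.K).L ν.r (g (j + 1))) (j + 1) := rfl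

/-- ★ **THE TERM's (2.1)-CHAIN, PULLED BACK TO THE COVER WITH `Ω₀ = T_η`, IS AN ADMISSIBLE SEQUENCE in lit-balaban p29's sense** ([III] (2.13) p. 256: unions of `L^jM`-cubes,
consecutive members separated by one layer) — FROM the membership `Ω_j ∈ 𝐃_j` of the (2.18) index of record (`Chain21.memΩ`: unions of `L^jMR_j`-cubes, nested partitions) and THE
SEPARATION OF RECORD in dag-n11-e's form `hullD (sideD … j) 3 (Ω_{j+1}) ⊆ Λ_j` (`B14SeparationOfRecord.separated_of_slotsOfRecord_ne_zero`: every sequence charged by a density of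
record), through the §1 bridges; cube sides dividing the period, `0 < M`. [cite: Balaban1988Convergent, (2.1)–(2.3) pp.254–255, (2.13) p.256, (3.5) p.265; Balaban1989LargeFieldI, (1.12) p.179] -/
theorem admissible_pullSeq_omegaT (s : SeqOfRecord F ν M g P.K k') (hM : 0 < M)
    (hdiv : ∀ j, 1 ≤ j → j ≤ k' → dCubeSide (F.P P.K).L M (RkOfRecord (F.P P.K).L ν.r (g j)) j ∣ (F.P P.K).sitesPerDir 0)
    (hsep : ∀ j, 1 ≤ j → j < k' → hullD (F.P P.K) (sideD F ν M P g j) 3 (s.Ω (j + 1)) ⊆ s.Λ j) :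
    Admissible (F.P P.K).L M k' (pullSeq (omegaT F ν M g s)) := by
  refine ⟨fun j hj => ?_, fun j hj x hx y hxy => ?_⟩
  · -- unions of `L^jM`-cubes
    rcases Nat.eq_zero_or_pos j with rfl | hj1
    · show IsUnionOfCubes (side (F.P P.K).L M 0) (cover (F.P P.K) ⁻¹' omegaT F ν M g s 0)
      rw [omegaT_zero, Set.preimage_univ]
      exact isUnionOfCubes_univ _
    · show IsUnionOfCubes (side (F.P P.K).L M j) (cover (F.P P.K) ⁻¹' omegaT F ν M g s j)
      rw [omegaT_of_ne_zero F ν M g s (by omega), omegaOfChain_eq s hj1 hj]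
      have hmem : s.Ω j ∈ unionsOfCubes (F.P P.K) (dCubeSide (F.P P.K).L M (RkOfRecord (F.P P.K).L ν.r (g j)) j) := s.chain.memΩ j hj1 hj
      have h1 := isUnionOfCubes_preimage_cover (dCubeSide_pos (F := F) (ν := ν) (P := P) (g := g) hM j) (hdiv j hj1 hj) hmem
      rw [dCubeSide_eq_side_mul] at h1
      exact isUnionOfCubes_of_mul h1
  · -- one-layer separation
    rcases Nat.eq_zero_or_pos j with rfl | hj1
    · show y ∈ cover (F.P P.K) ⁻¹' omegaT F ν M g s 0
      rw [omegaT_zero]; trivial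
    · have hxΩ : cover (F.P P.K) x ∈ s.Ω (j + 1) := by
        have : x ∈ cover (F.P P.K) ⁻¹' omegaT F ν M g s (j + 1) := hx
        rwa [Set.mem_preimage, omegaT_of_ne_zero F ν M g s (by omega), omegaOfChain_eq s (by omega) (by omega)] at this
      show y ∈ cover (F.P P.K) ⁻¹' omegaT F ν M g s j
      rw [Set.mem_preimage, omegaT_of_ne_zero F ν M g s (by omega), omegaOfChain_eq s hj1 hj.le]
      -- the `𝐃_{j+1}`-side `S ≥ L^{j+1}M`
      have hS : 0 < sideD F ν M P g j := by rw [sideD_eq]; exact dCubeSide_pos (F := F) (ν := ν) (P := P) (g := g) hM _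
      have hle : ((side (F.P P.K).L M (j + 1) : ℕ) : ℤ) - 1 ≤ ((1 : ℕ) : ℤ) * (sideD F ν M P g j : ℕ) := by
        have h1 := B14SeparationOfRecord.one_le_RkOfRecord (L := (F.P P.K).L) (F.P P.K).L_pos ν.r (g (j + 1))
        have : side (F.P P.K).L M (j + 1) ≤ sideD F ν M P g j := by
          rw [sideD_eq, dCubeSide_eq_side_mul]
          exact Nat.le_mul_of_pos_right _ h1
        have : ((side (F.P P.K).L M (j + 1) : ℕ) : ℤ) ≤ (sideD F ν M P g j : ℕ) := by exact_mod_cast this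
        push_cast; linarith
      have hnear : IdxNear (sideD F ν M P g j) 1 y x := (idxNear_of_within _ 1 hS (Within.mono hle hxy)).symm
      have hy : y ∈ enl (sideD F ν M P g j) 3 (cover (F.P P.K) ⁻¹' s.Ω (j + 1)) :=
        enl_mono_layers _ (by norm_num) _ ⟨x, hxΩ, hnear⟩
      rw [← preimage_cover_hullD hS (by rw [sideD_eq]; exact hdiv (j + 1) (by omega) (by omega))] at hy
      exact s.chain.Λ_subset j hj1 hj.le (hsep j hj1 hj hy)

/-- ★★ **lit-balaban p29's LOCATED `Hypotheses` BUNDLE AT THE TERM's DATA — SIX NUMERIC FIELDS AND THE ADMISSIBILITY OF THE CHAIN DISCHARGED FROM THE RECORD**, the two located facts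
about the component union `Z` and the last-`N`-steps margin DISPLAYED in TORUS form: `2 ≤ L` (the torus), `1 ≤ M`, `1 ≤ R_j` ((2.5)), `h < k₀` ⇐ `N₀ < N ≤ k′`, `k₀ + 2 ≤ k′` ⇐
`2 ≤ N₀`, the `N₀`-equation (p29's `hN₀`; module 16 §3 from one step of monotone couplings), `adm` ⇐ `admissible_pullSeq_omegaT`; DISPLAYED: the separation of record (dag-n11-e's shape —
a theorem for every charged sequence), the divisibilities, and p. 177's located readings — (ii) *«in the preceding N renormalization steps no new large field regions were created inside
this component»* as the EIGHT-LAYER MARGIN `Z ∩ Ω_{j+1}^{∼8} ⊆ Ω_j`, `h ≤ j ≤ k₀` ([III] (3.5)), and *«the union of the above class of components»* of `Λ_kᶜ` as: `Z` a union of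
`𝐃_{k′}`-cubes, closed under cube-adjacency outside `Ω_{k′}`. [cite: Balaban1989LargeFieldI, p.177, (1.10)–(1.12) p.179; Balaban1988Convergent, (2.1)–(2.3) pp.254–255, (2.5) p.255, (2.13) p.256, (3.5) p.265] -/
theorem hypotheses_of_record {N : ℕ} [NeZero N] (σ : Sit189 F N P.K) (s : SeqOfRecord F ν M g P.K k') {N₀ Nm : ℕ} (hM : 0 < M) (hN2 : 2 ≤ N₀) (hN0m : N₀ < Nm) (hNmk : Nm ≤ k')
    (hN₀eq : dCubeSide (F.P P.K).L M (RkOfRecord (F.P P.K).L ν.r (g (k' + 1 - N₀))) (k' + 1 - N₀) = side (F.P P.K).L M k')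
    (hdiv : ∀ j, 1 ≤ j → j ≤ k' → dCubeSide (F.P P.K).L M (RkOfRecord (F.P P.K).L ν.r (g j)) j ∣ (F.P P.K).sitesPerDir 0)
    (hsep : ∀ j, 1 ≤ j → j < k' → hullD (F.P P.K) (sideD F ν M P g j) 3 (s.Ω (j + 1)) ⊆ s.Λ j)
    (hmargin : ∀ j, k' - Nm ≤ j → 1 ≤ j → j ≤ k' - N₀ →
      σ.Z ∩ hullD (F.P P.K) (dCubeSide (F.P P.K).L M (RkOfRecord (F.P P.K).L ν.r (g (j + 1))) (j + 1)) 8 (omegaOfChain s (j + 1)) ⊆ omegaOfChain s j)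
    (hZcubes : σ.Z ∈ unionsOfCubes (F.P P.K) (dCubeSide (F.P P.K).L M (RkOfRecord (F.P P.K).L ν.r (g k')) k'))
    (hZclosed : ∀ a b : Site (F.P P.K) 0, b ∈ σ.Z → a ∉ omegaOfChain s k' →
      a ∈ hullD (F.P P.K) (dCubeSide (F.P P.K).L M (RkOfRecord (F.P P.K).L ν.r (g k')) k') 1 {b} → a ∈ σ.Z) :
    Hypotheses (F.P P.K).L M (k' - Nm) (k' - N₀) k' (fun j => RkOfRecord (F.P P.K).L ν.r (g j)) (pullSeq (omegaT F ν M g s)) (cover (F.P P.K) ⁻¹' σ.Z) := by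
  have hL := B15Claim189N0OfRecord.two_le_L (F := F) P
  have hSk : 0 < dCubeSide (F.P P.K).L M (RkOfRecord (F.P P.K).L ν.r (g k')) k' := dCubeSide_pos (F := F) (ν := ν) (P := P) (g := g) hM _
  refine
    { hL := hL
      hM := hM
      hR := fun j => B14SeparationOfRecord.one_le_RkOfRecord (F.P P.K).L_pos ν.r (g j)
      hhk := by omega
      hk := by omega
      hN₀ := ?_
      adm := admissible_pullSeq_omegaT s hM hdiv hsep
      margin := ?_
      classZ := ?_ }
  · -- the `N₀`-equation in p29's spelling
    show side (F.P P.K).L M (k' - N₀ + 1) * RkOfRecord (F.P P.K).L ν.r (g (k' - N₀ + 1)) = side (F.P P.K).L M k'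
    rw [← dCubeSide_eq_side_mul, show k' - N₀ + 1 = k' + 1 - N₀ from by omega]
    exact hN₀eq
  · -- the eight-layer margin, torus form ⇒ cover form
    intro j hhj hjk₀ x hx
    rcases Nat.eq_zero_or_pos j with rfl | hj1
    · show x ∈ cover (F.P P.K) ⁻¹' omegaT F ν M g s 0
      rw [omegaT_zero]; trivial
    · obtain ⟨hxZ, hxe⟩ := hx
      have hdj : dCubeSide (F.P P.K).L M (RkOfRecord (F.P P.K).L ν.r (g (j + 1))) (j + 1) ∣ (F.P P.K).sitesPerDir 0 := hdiv (j + 1) (by omega) (by omega)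
      have hxe' : x ∈ enl (dCubeSide (F.P P.K).L M (RkOfRecord (F.P P.K).L ν.r (g (j + 1))) (j + 1)) 8 (cover (F.P P.K) ⁻¹' omegaOfChain s (j + 1)) := by
        have : x ∈ enl (side (F.P P.K).L M (j + 1) * RkOfRecord (F.P P.K).L ν.r (g (j + 1))) 8 (pullSeq (omegaT F ν M g s) (j + 1)) := hxe
        rwa [pullSeq_omegaT_of_ne_zero F ν M g s (by omega), ← dCubeSide_eq_side_mul] at this
      rw [← preimage_cover_hullD (dCubeSide_pos (F := F) (ν := ν) (P := P) (g := g) hM _) hdj] at hxe'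
      show x ∈ cover (F.P P.K) ⁻¹' omegaT F ν M g s j
      rw [Set.mem_preimage, omegaT_of_ne_zero F ν M g s (by omega)]
      exact hmargin j hhj hj1 hjk₀ ⟨hxZ, hxe'⟩
  · -- `Z`: a union of `𝐃_{k′}`-cubes closed under adjacency outside `Ω_{k′}`
    refine ⟨?_, fun x y hy hx hn => ?_⟩
    · have h1 := isUnionOfCubes_preimage_cover hSk (hdiv k' (by omega) le_rfl) hZcubes
      rwa [dCubeSide_eq_side_mul] at h1
    · have hx' : cover (F.P P.K) x ∉ omegaOfChain s k' := by
        intro h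
        apply hx
        show x ∈ cover (F.P P.K) ⁻¹' omegaT F ν M g s k'
        rw [Set.mem_preimage, omegaT_of_ne_zero F ν M g s (by omega)]
        exact h
      have hn' : IdxNear (dCubeSide (F.P P.K).L M (RkOfRecord (F.P P.K).L ν.r (g k')) k') 1 x y := by
        rwa [dCubeSide_eq_side_mul]
      exact hZclosed _ _ hy hx' (cover_mem_hullD_singleton_of_idxNear hSk (hdiv k' (by omega) le_rfl) hn')

end Adm

/-! ## §3. At the fully pinned stack: p29's structure from RECORD inputs + the two located facts about `Z`; at Record 13 the separation is dag-n11-e's theorem for charged terms -/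

section Stack

open B15Claim189Assembly (Setting189)
open B15Claim189PinsOfHistory (D189OfHist sitOfHist)
open B15Claim189PrintedConditions (omegaOfChain)
open B15Claim189LambdaPin (enlD dCubeSide_pos)
open B15Claim189ZppOfRecordPin (zppOfRecordT Zpp_stack_structure)
open B15DeterminingSets (MSField)
open B15Eq112Admissible (Admissible Hypotheses)

variable {F : T4Family} {N : ℕ} [NeZero N] {ν : Stage7Numerics} {A₁ : ℝ} {M : ℕ} (Nm : ℕ) (P : B12.RunParams) (σ : Sit189 F N P.K) {g : ℕ → ℝ} {k' : ℕ}
  (s : SeqOfRecord F ν M g P.K k') (N₀ p₁ kd hs' : ℕ) (S : Set (Site (F.P P.K) 0)) (enl₁ enl₂ enl₃ : ℕ → ℕ → Set (Site (F.P P.K) 0) → Set (Site (F.P P.K) 0))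

/-- ★★★ **THE (1.89) SITUATION's `Z″`-STRUCTURE FROM RECORD INPUTS.**  At the stack `pinZres → pinSides → pinXΩ4 → pinOmegaPP → pinLambda → pinDistAt → pinZpp → pinCubes → sitOfHist`,
module 19's `Zpp_stack_structure` with lit-balaban p29's `Hypotheses` bundle SUPPLIED by `hypotheses_of_record`: ABOVE `h` the situation's `Z″_j` are NESTED, DISJOINT FROM `Ω_j`
(`j ≤ k′`), `Z ∖ Z″_{h+1} ⊆ Ω_h` (`Ω₀ = T_η`), and the (1.12) domains built from them form an ADMISSIBLE sequence on the cover — FROM: `0 < M`, `2 ≤ N₀ < N ≤ k′`, the `N₀`-equation, the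
cube sides of record dividing the torus period, THE SEPARATION OF RECORD (dag-n11-e's shape; a theorem for every charged sequence, `separated_of_slotsOfRecord₁₃_ne_zero`), and the
two located readings of p. 177 about the term's component union `Z` (eight-layer margin of the last `N` steps; `Z` a union of `𝐃_{k′}`-cubes closed under adjacency outside `Ω_{k′}`).
[cite: Balaban1989LargeFieldI, p.177, (1.10)–(1.12) p.179, (1.89) p.198; Balaban1988Convergent, (2.1)–(2.3) pp.254–255, (2.13) p.256, (3.5) p.265; Balaban1987RG1, (0.1) p.251] -/
theorem Zpp_stack_structure_of_record
    {D : Setting189 (F.P P.K) (SU N) (MSField (F.P P.K) (SU N) × ((j : ℕ) → VecField (F.P P.K) j (EuclideanSpace ℝ (Fin (N ^ 2 - 1))))) (Pt (F.P P.K).d)}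
    (hD : D = D189OfHist ν P (sitOfHist ν A₁ M Nm P
      ((((((((σ.pinZres ν M g s N₀).pinSides ν g hs' k').pinXΩ4 s enl₁).pinOmegaPP s Nm enl₂).pinLambda s N₀ enl₃).pinDistAt kd).pinZpp s N₀ Nm (enlD F ν M P g)).pinCubes S) g s N₀ p₁) g)
    (hM : 0 < M) (hN2 : 2 ≤ N₀) (hN0m : N₀ < Nm) (hNmk : Nm ≤ k')
    (hN₀eq : dCubeSide (F.P P.K).L M (RkOfRecord (F.P P.K).L ν.r (g (k' + 1 - N₀))) (k' + 1 - N₀) = side (F.P P.K).L M k')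
    (hdiv : ∀ j, 1 ≤ j → j ≤ k' → dCubeSide (F.P P.K).L M (RkOfRecord (F.P P.K).L ν.r (g j)) j ∣ (F.P P.K).sitesPerDir 0)
    (hdiv0 : side (F.P P.K).L M 0 * RkOfRecord (F.P P.K).L ν.r (g 0) ∣ (F.P P.K).sitesPerDir 0)
    (hsep : ∀ j, 1 ≤ j → j < k' → hullD (F.P P.K) (sideD F ν M P g j) 3 (s.Ω (j + 1)) ⊆ s.Λ j)
    (hmargin : ∀ j, k' - Nm ≤ j → 1 ≤ j → j ≤ k' - N₀ →
      σ.Z ∩ hullD (F.P P.K) (dCubeSide (F.P P.K).L M (RkOfRecord (F.P P.K).L ν.r (g (j + 1))) (j + 1)) 8 (omegaOfChain s (j + 1)) ⊆ omegaOfChain s j)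
    (hZcubes : σ.Z ∈ unionsOfCubes (F.P P.K) (dCubeSide (F.P P.K).L M (RkOfRecord (F.P P.K).L ν.r (g k')) k'))
    (hZclosed : ∀ a b : Site (F.P P.K) 0, b ∈ σ.Z → a ∉ omegaOfChain s k' →
      a ∈ hullD (F.P P.K) (dCubeSide (F.P P.K).L M (RkOfRecord (F.P P.K).L ν.r (g k')) k') 1 {b} → a ∈ σ.Z) :
    (∀ j, k' - Nm < j → D.Zpp j ⊆ D.Zpp (j + 1)) ∧ (∀ j, k' - Nm < j → j ≤ k' → Disjoint (D.Zpp j) (D.Ω j)) ∧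
      σ.Z \ D.Zpp (k' - Nm + 1) ⊆ omegaT F ν M g s (k' - Nm) ∧
      Admissible (F.P P.K).L M k' (pullSeq (B15DeterminingSets.omegaPP (omegaT F ν M g s) (zppOfRecordT F ν M P g s N₀ σ.Z) σ.Z (k' - Nm))) := by
  have hdk : side (F.P P.K).L M k' ∣ (F.P P.K).sitesPerDir 0 :=
    (Dvd.intro _ (dCubeSide_eq_side_mul (F.P P.K).L M (RkOfRecord (F.P P.K).L ν.r (g k')) k').symm).trans (hdiv k' (by omega) le_rfl)
  refine Zpp_stack_structure Nm P σ s N₀ p₁ kd hs' S enl₁ enl₂ enl₃ hD hM hN2 hN0m.le (by omega) hdk (fun j hj hjk => hdiv j (by omega) (by omega)) hN₀eq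
    (hypotheses_of_record σ s hM hN2 hN0m hNmk hN₀eq hdiv hsep hmargin hZcubes hZclosed) (fun j hj => ?_)
  rcases Nat.eq_zero_or_pos j with rfl | hj1
  · exact hdiv0
  · rw [← dCubeSide_eq_side_mul]; exact hdiv j hj1 (by omega)

variable {θ : Stage13Params F N}

/-- **AT RECORD 13, THE SEPARATION INPUT IS dag-n11-e's THEOREM FOR EVERY CHARGED TERM**: a term `s` of `ρ_{k′}` with a non-zero slot of record has its chain (pulled back, `Ω₀ = T_η`)
ADMISSIBLE in p29's sense (`0 < M` of record, cube sides dividing the period). [cite: Balaban1988Convergent, (2.1) p.254, p.256, (2.13) p.256, (2.18) p.257, (3.5) p.265; Balaban1989LargeFieldI, (1.12) p.179] -/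
theorem admissible_pullSeq_omegaT₁₃_of_slots_ne_zero (s₁₃ : SeqOfRecord F θ.ν θ.τ9.M (gOfRecord₁₃ F N θ P) P.K k') (hM : 0 < θ.τ9.M)
    (hdiv : ∀ j, 1 ≤ j → j ≤ k' → dCubeSide (F.P P.K).L θ.τ9.M (RkOfRecord (F.P P.K).L θ.ν.r (gOfRecord₁₃ F N θ P j)) j ∣ (F.P P.K).sitesPerDir 0)
    (hs : slotsOfRecord F N θ.ν θ.τ9 (EOfRecord₁₃ F N θ) (wOfRecord₉ F N θ.toStage9Params) θ.ppSel P (gOfRecord₁₃ F N θ P) k' s₁₃ ≠ 0) :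
    Admissible (F.P P.K).L θ.τ9.M k' (pullSeq (omegaT F θ.ν θ.τ9.M (gOfRecord₁₃ F N θ P) s₁₃)) :=
  admissible_pullSeq_omegaT s₁₃ hM hdiv (B14SeparationOfRecord.separated_of_slotsOfRecord₁₃_ne_zero F N θ P k' s₁₃ hs)

end Stack

end B15Claim189HypothesesOfRecord

end Literature.MathematicalPhysics.QuantumFieldTheory.Balaban1983to89
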